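import Literature.NumberTheory.EllipticCurves.CMTorsionGaloisImage
import Literature.NumberTheory.EllipticCurves.SupersingularDensityDeuringCriterionProofs
import Literature.NumberTheory.EllipticCurves.IsogenyGeomEndRingGaloisProofs
import Literature.NumberTheory.EllipticCurves.IsogenyGeomEndRingCommProofs
import Literature.NumberTheory.EllipticCurves.IsogenyNotRationalCMProofs
import HarnessLib

/-!
# The quadratic character twisting `√D` on a CM elliptic curve over `ℚ` (Lang's Remark), and the
# elementary conjuncts of `cmTorsion_cartanImage` — proofs

Theorem-only `Proofs` companion (D-0014 append protocol: nothing is stated here as a fact; no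
`sorry`) of `Literature.NumberTheory.EllipticCurves.CMTorsionGaloisImage`, whose named fact
`Literature.NumberTheory.EllipticCurves.cmTorsion_cartanImage` (Lang, *Elliptic Functions*,
Ch. 10 §4, Remark + Thm. 8, read on `ℓ`-torsion) asserts, uniformly for CM elliptic curves `W/ℚ`
and primes `ℓ > L₀`: an endomorphism `φ = √D` of `W[ℓ]` with (1) `φ² = D`, (2) `ℓ ∤ D`, (3) `φ` not a
scalar, a character `χ : Γ_ℚ → {±1}` with (4) `χ ≠ 1` and (5) `φ(σP) = χ(σ)·σφ(P)`, and (6) the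
Cartan-image clause. This file PROVES, from the tree's CM library, everything except (6) and the
uniformity of the threshold in `W`:

* `WeierstrassCurve.exists_sq_eq_intCast_quadraticTwist_of_hasCM` — **Lang's Remark / Silverman
  *AT* Thm. II.2.2(a) for a CM curve over `ℚ`, on all of `W(ℚ̄)`**: there are `ψ ∈ End_{ℚ̄}(W)`,
  `D < 0` with `ψ² = D`, and a NON-TRIVIAL character `χ : Γ_ℚ →* ℤˣ` with
  `ψ(σP) = χ(σ)·σψ(P)` for all `σ ∈ Γ_ℚ`, `P ∈ W(ℚ̄)` (so `ψ` is defined exactly over the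
  quadratic field cut out by `χ`, the CM field). Proof: `ψ` from
  `WeierstrassCurve.exists_sq_eq_intCast_of_hasCM` (*AEC* III.6.3, III.9.4); each conjugate
  `σψσ⁻¹` lies in `End_{ℚ̄}(W)` (`WeierstrassCurve.conj_mem_geomEndRing`) and squares to `D`, so
  `(σψσ⁻¹ − ψ)(σψσ⁻¹ + ψ) = 0` in the commutative domain `End_{ℚ̄}(W)`
  (`WeierstrassCurve.geomEndRing_comm_holds`, `WeierstrassCurve.isDomain_geomEndRing`), i.e.
  `σψσ⁻¹ = χ(σ)ψ` with `χ(σ) = ±1` unique (`2ψ ≠ 0`, `WeierstrassCurve.charZero_geomEndRing`),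
  whence a homomorphism `χ`; `χ ≠ 1` because `ψ ∉ ℤ` is not defined over `ℚ`
  (`WeierstrassCurve.not_hasRationalCM_holds`, *AT* II.2.2 with Remark II.2.2.2).
* `WeierstrassCurve.exists_sqrt_twist_geomTorsion_of_hasCM` — the restriction `φ = ψ|_{W[n]}` to
  every torsion level: (1), (5) on `W[n]` for all `n : ℤ`, with the same `D`, `χ` ((4)).
* `WeierstrassCurve.geomTorsion_ne_smul_of_twist` — **(3) from (1), (2), (5)**: on `W[ℓ]`, `ℓ` an odd
  prime with `ℓ ∤ D`, an endomorphism `φ` with `φ² = D` which anti-commutes with some `σ₀ ∈ Γ_ℚ`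
  is not a scalar: `φ = c` would give `2c = 0` on `W[ℓ] ≠ 0` (`#W[ℓ] = ℓ²`,
  `WeierstrassCurve.card_torsionPoints_eq_sq_holds`), so `ℓ ∣ c`, `φ = 0`, `D = φ² = 0` on `W[ℓ]`,
  `ℓ ∣ D`.
* `WeierstrassCurve.cmTorsion_sqrt_twist_of_hasCM` — **conjuncts (1)–(5) of the fact with a
  threshold depending on the curve** (`L = max 2 |D|`): for every CM `W/ℚ` there is `L` such that
  for all primes `ℓ > L` there are `φ`, `D`, `χ` with (1)–(5), in the fact's exact vocabulary.
* `Literature.NumberTheory.EllipticCurves.cmTorsion_cartanImage_of_sqrt_twist_cartan` — **the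
  fact minus conjunct (3) implies the fact** (threshold `max 2 L₀`): the discharger only has to
  supply (1), (2), (4), (5), (6) uniformly.
* Helpers: `WeierstrassCurve.geomTorsion_eq_zero_of_zsmul_eq_zero` (Bézout on `W[ℓ]`),
  `WeierstrassCurve.exists_ne_zero_geomTorsion_prime` (`W[ℓ] ≠ 0`).

What remains of `cmTorsion_cartanImage` after this file: the Cartan-image clause (6) — the main
theorem of complex multiplication proper (ideles of `K` acting on `k/𝔞`, reciprocity) — and the
uniformity `L₀ = 163` of the threshold, which needs `ψ` to be chosen with `ψ² = disc End_{ℚ̄}(W)`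
(one of the thirteen class-number-one discriminants, `WeierstrassCurve.hasCM_iff_j_mem_holds`)
rather than the `ψ = 2φ₀ − t` of `exists_sq_eq_intCast_of_hasCM`, whose `D = t² − 4n` depends on
the chosen generator `φ₀`.

## References

* S. Lang, *Elliptic Functions*, 2nd ed., GTM 112 (1987), Ch. 10 §4, Remark (all endomorphisms
  are defined over `K ⊇ k`; `θ(μ)^σ = θ(μ^σ)`). [Lang1987]
* J. H. Silverman, *Advanced Topics in the Arithmetic of Elliptic Curves*, GTM 151 (1994),
  Thm. II.2.2(a),(b) and Remark II.2.2.2. [SilvermanAdvancedTopics1994]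
* J. H. Silverman, *The Arithmetic of Elliptic Curves*, 2nd ed. (2009), Cor. III.6.3, III.6.4(b),
  Cor. III.9.4. [SilvermanAEC2009]

## Design

Theorems only, deliberate dot-notation extensions in `namespace WeierstrassCurve` (as the CM
library they extend); `noncomputable section`, `open scoped Classical`. The conjugate of an
endomorphism is written `c σ * ψ * c σ⁻¹` with `c = DistribMulAction.toAddMonoidEnd Γ_ℚ W(ℚ̄)`
(pointwise `P ↦ σ • ψ (σ⁻¹ • P)`, as in `IsogenyGeomEndRingGaloisProofs`); the character `χ` is
built by `choose` from the pointwise uniqueness of the sign, not by deciding `σψσ⁻¹ = ψ`.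
-/

noncomputable section

open scoped Classical

namespace WeierstrassCurve

open Literature.NumberTheory.EllipticCurves
open Field (absoluteGaloisGroup)

variable (W : WeierstrassCurve ℚ) [W.IsElliptic]

/-! ## Lang's Remark over `ℚ`: `σ ∘ √D ∘ σ⁻¹ = χ_K(σ) √D` -/

/-- **The quadratic character twisting a CM endomorphism of a curve over `ℚ`.** For an elliptic
curve `W/ℚ` with (geometric) complex multiplication there are a geometric endomorphism `ψ`, an
integer `D < 0` with `ψ ∘ ψ = [D]`, and a non-trivial homomorphism `χ : Γ_ℚ → ℤˣ = {±1}` such that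
`ψ(σ • P) = χ(σ) • σ • ψ(P)` for all `σ ∈ Γ_ℚ` and `P ∈ W(ℚ̄)` — equivalently
`σ ∘ ψ ∘ σ⁻¹ = χ(σ) ψ`: `ψ = [√D]` is defined over the quadratic field `ℚ̄^{ker χ} = ℚ(√D)` and is
conjugated to `−ψ` by the non-trivial coset. This is Lang, *Elliptic Functions*, Ch. 10 §4, Remark
("`k ⊂ K` iff every element of `End(A)` is defined over `K`", via `θ(μ)^σ = θ(μ^σ)`) = Silverman,
*Advanced Topics*, Thm. II.2.2(a) (`[α]_E^σ = [α^σ]_{E^σ}`) for `E` over `ℚ`, proved here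
structurally: `σψσ⁻¹ ∈ End_{ℚ̄}(W)` squares to `D`, and `x² = ψ²` forces `x = ±ψ` in the commutative
domain `End_{ℚ̄}(W)`; the sign is multiplicative in `σ`; it is not identically `1` since no curve
over `ℚ` has `ℚ`-rational CM (`not_hasRationalCM_holds`).
[cite: Lang1987, Ch. 10 §4, Remark] -/
theorem exists_sq_eq_intCast_quadraticTwist_of_hasCM (h : W.HasCM) :
    ∃ ψ ∈ W.geomEndRing, ∃ (D : ℤ) (χ : absoluteGaloisGroup ℚ →* ℤˣ),
      D < 0 ∧ ψ * ψ = (D : AddMonoid.End W.geomPoints) ∧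
      (∃ σ : absoluteGaloisGroup ℚ, χ σ ≠ 1) ∧
      ∀ (σ : absoluteGaloisGroup ℚ) (P : W.geomPoints),
        ψ (σ • P) = ((χ σ : ℤˣ) : ℤ) • σ • ψ P := by
  obtain ⟨ψ, hψR, D, hD, hψψ⟩ := exists_sq_eq_intCast_of_hasCM W h
  haveI := isDomain_geomEndRing W
  haveI := charZero_geomEndRing W
  -- the Galois group acting through ring endomorphisms `c σ`; the conjugate is `c σ * ψ * c σ⁻¹`
  set c : absoluteGaloisGroup ℚ →* AddMonoid.End W.geomPoints :=
    DistribMulAction.toAddMonoidEnd (absoluteGaloisGroup ℚ) W.geomPoints with hc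
  have hconjP : ∀ (σ : absoluteGaloisGroup ℚ) (P : W.geomPoints),
      (c σ * ψ * c σ⁻¹) P = σ • ψ (σ⁻¹ • P) := fun σ P ↦ rfl
  -- the element `y = ψ` of the domain `R = End_{ℚ̄}(E)`; `y ≠ 0`, `2ψ ≠ 0`
  set y : W.geomEndRing := ⟨ψ, hψR⟩ with hy
  have hyy : y * y = (D : W.geomEndRing) := Subtype.ext (by push_cast; exact hψψ)
  have hy0 : y ≠ 0 := by
    intro h0
    rw [h0, mul_zero] at hyy
    have : (D : W.geomEndRing) = 0 := hyy.symm
    rw [Int.cast_eq_zero] at this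
    omega
  have h2ψ : ∃ P : W.geomPoints, ψ P + ψ P ≠ 0 := by
    by_contra hall
    push Not at hall
    apply hy0
    have h2 : (2 : W.geomEndRing) * y = 0 := by
      apply Subtype.ext
      change ((2 : AddMonoid.End W.geomPoints) * ψ) = 0
      ext P
      change (2 : AddMonoid.End W.geomPoints) (ψ P) = 0
      rw [AddMonoid.End.ofNat_apply, two_nsmul]
      exact hall P
    exact (mul_eq_zero.mp h2).resolve_left two_ne_zero
  -- Step 1: every conjugate `σψσ⁻¹` is `ψ` or `-ψ`
  have hconj : ∀ σ : absoluteGaloisGroup ℚ, c σ * ψ * c σ⁻¹ = ψ ∨ c σ * ψ * c σ⁻¹ = -ψ := by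
    intro σ
    have hmem : c σ * ψ * c σ⁻¹ ∈ W.geomEndRing := conj_mem_geomEndRing W hψR σ
    -- `(σψσ⁻¹)² = σ ψ² σ⁻¹ = D`
    have hsq : (c σ * ψ * c σ⁻¹) * (c σ * ψ * c σ⁻¹) = (D : AddMonoid.End W.geomPoints) := by
      calc (c σ * ψ * c σ⁻¹) * (c σ * ψ * c σ⁻¹)
          = c σ * ψ * (c σ⁻¹ * c σ) * ψ * c σ⁻¹ := by simp only [mul_assoc]
        _ = c σ * (ψ * ψ) * c σ⁻¹ := by
            rw [← map_mul, inv_mul_cancel, map_one, mul_one, mul_assoc (c σ)]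
        _ = (D : AddMonoid.End W.geomPoints) * (c σ * c σ⁻¹) := by
            rw [hψψ, ((Int.cast_commute D (c σ)).symm).eq, mul_assoc]
        _ = (D : AddMonoid.End W.geomPoints) := by
            rw [← map_mul, mul_inv_cancel, map_one, mul_one]
    set x : W.geomEndRing := ⟨c σ * ψ * c σ⁻¹, hmem⟩ with hx
    have hxx : x * x = (D : W.geomEndRing) := Subtype.ext (by push_cast; exact hsq)
    have hcomm : x * y = y * x := Subtype.ext (W.geomEndRing_comm_holds _ _ x.2 y.2)
    have hprod : (x - y) * (x + y) = 0 := by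
      rw [sub_mul, mul_add, mul_add, hcomm, hxx, hyy]; abel
    rcases mul_eq_zero.mp hprod with h0 | h0
    · exact Or.inl (congrArg Subtype.val (sub_eq_zero.mp h0))
    · exact Or.inr (congrArg Subtype.val (eq_neg_of_add_eq_zero_left h0))
  -- Step 2: pointwise, `σ • ψ (σ⁻¹ • P) = u • ψ P` for a unit `u = ±1`, and `u` is unique
  have hex : ∀ σ : absoluteGaloisGroup ℚ, ∃ u : ℤˣ, ∀ P : W.geomPoints,
      σ • ψ (σ⁻¹ • P) = (u : ℤ) • ψ P := by
    intro σ
    rcases hconj σ with h1 | h1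
    · exact ⟨1, fun P ↦ by rw [← hconjP, h1, Units.val_one, one_zsmul]⟩
    · exact ⟨-1, fun P ↦ by
        rw [← hconjP, h1, Units.val_neg, Units.val_one, neg_one_zsmul]; rfl⟩
  have huniq : ∀ u v : ℤˣ, (∀ P : W.geomPoints, (u : ℤ) • ψ P = (v : ℤ) • ψ P) → u = v := by
    intro u v huv
    by_contra hne
    obtain ⟨P, hP⟩ := h2ψ
    apply hP
    have key : ψ P = -ψ P := by
      rcases Int.units_eq_one_or u with rfl | rfl <;> rcases Int.units_eq_one_or v with rfl | rfl
      · exact (hne rfl).elim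
      · simpa using huv P
      · simpa [eq_neg_iff_add_eq_zero, ← two_nsmul] using (huv P).symm
      · exact (hne rfl).elim
    rw [← sub_eq_zero, sub_neg_eq_add] at key
    exact key
  choose ε hε using hex
  have hε1 : ε 1 = 1 := huniq _ _ fun P ↦ by
    rw [← hε 1 P, inv_one, one_smul, one_smul, Units.val_one, one_zsmul]
  have hεmul : ∀ σ τ, ε (σ * τ) = ε σ * ε τ := fun σ τ ↦ huniq _ _ fun P ↦ by
    rw [← hε (σ * τ) P, mul_inv_rev, mul_smul, mul_smul, hε τ (σ⁻¹ • P), smul_comm σ,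
      hε σ P, smul_smul, mul_comm, Units.val_mul]
  let χ : absoluteGaloisGroup ℚ →* ℤˣ := { toFun := ε, map_one' := hε1, map_mul' := hεmul }
  have hχ : ∀ σ, χ σ = ε σ := fun σ ↦ rfl
  -- Step 3: the twisting relation `ψ (σ • P) = χ σ • σ • ψ P`
  have hrel : ∀ (σ : absoluteGaloisGroup ℚ) (P : W.geomPoints),
      ψ (σ • P) = ((χ σ : ℤˣ) : ℤ) • σ • ψ P := fun σ P ↦ by
    have h1 := hε σ (σ • P)
    rw [inv_smul_smul] at h1
    rw [hχ, h1, smul_smul, ← Units.val_mul, Int.units_mul_self, Units.val_one, one_zsmul]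
  -- Step 4: `χ ≠ 1`, for otherwise `ψ` would be a `ℚ`-rational complex multiplication
  have hne : ∃ σ : absoluteGaloisGroup ℚ, χ σ ≠ 1 := by
    by_contra hall
    push Not at hall
    have hequiv : ψ ∈ W.equivariantSubring := fun σ P ↦ by
      rw [hrel σ P, hall σ, Units.val_one, one_zsmul]
    refine not_hasRationalCM_holds W ⟨ψ, ⟨hψR, hequiv⟩, fun n hn ↦ ?_⟩
    have hDn : (D : W.geomEndRing) = (n * n : ℤ) := by
      rw [← hyy]
      apply Subtype.ext
      push_cast
      change ψ * ψ = _
      rw [hn]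
    have hDn' : D = n * n := by exact_mod_cast hDn
    nlinarith [mul_self_nonneg n]
  exact ⟨ψ, hψR, D, χ, hD, hψψ, hne, hrel⟩

/-! ## Restriction to the torsion: conjuncts (1), (4), (5) at every level -/

/-- **`√D` and its twist on `W[n]`, for every `n`.** For a CM curve `W/ℚ`: `ψ ∈ End_{ℚ̄}(W)`,
`D < 0`, a non-trivial `χ : Γ_ℚ →* ℤˣ`, and for every `n : ℤ` the restriction `φ = ψ|_{W[n]}`
(an additive map preserves `W[n]`) with `φ ∘ φ = D` and `φ(σ • P) = χ(σ) • σ • φ(P)` on `W[n]` —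
conjuncts (1), (4), (5) of `Literature.NumberTheory.EllipticCurves.cmTorsion_cartanImage`, at
every level and with `D`, `χ` independent of `n`. [cite: Lang1987, Ch. 10 §4, Remark] -/
theorem exists_sqrt_twist_geomTorsion_of_hasCM (h : W.HasCM) :
    ∃ ψ ∈ W.geomEndRing, ∃ (D : ℤ) (χ : absoluteGaloisGroup ℚ →* ℤˣ),
      D < 0 ∧ ψ * ψ = (D : AddMonoid.End W.geomPoints) ∧
      (∃ σ : absoluteGaloisGroup ℚ, χ σ ≠ 1) ∧
      ∀ n : ℤ, ∃ φ : AddMonoid.End (W.geomTorsion n),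
        (∀ P : W.geomTorsion n, ((φ P : W.geomTorsion n) : W.geomPoints) = ψ P) ∧
        (∀ P : W.geomTorsion n, φ (φ P) = D • P) ∧
        (∀ (σ : absoluteGaloisGroup ℚ) (P : W.geomTorsion n),
          φ (σ • P) = ((χ σ : ℤˣ) : ℤ) • σ • φ P) := by
  obtain ⟨ψ, hψR, D, χ, hD, hψψ, hne, hrel⟩ := W.exists_sq_eq_intCast_quadraticTwist_of_hasCM h
  refine ⟨ψ, hψR, D, χ, hD, hψψ, hne, fun n ↦ ?_⟩
  have hψψP : ∀ P : W.geomPoints, ψ (ψ P) = D • P := fun P ↦ by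
    have := congrArg (fun f : AddMonoid.End W.geomPoints ↦ f P) hψψ
    simpa only [AddMonoid.End.coe_mul, Function.comp_apply, AddMonoid.End.intCast_apply] using this
  -- `ψ` preserves `E[n]` (it is additive)
  have hmem : ∀ P : W.geomTorsion n, ψ (P : W.geomPoints) ∈ W.geomTorsion n := fun P ↦ by
    have hP := P.2
    rw [Submodule.mem_toAddSubgroup, Submodule.mem_torsionBy_iff] at hP ⊢
    rw [← map_zsmul, hP, map_zero]
  let φ : AddMonoid.End (W.geomTorsion n) :=
    ((ψ : W.geomPoints →+ W.geomPoints).restrict (W.geomTorsion n)).codRestrict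
      (W.geomTorsion n) hmem
  have hφ : ∀ P : W.geomTorsion n, ((φ P : W.geomTorsion n) : W.geomPoints) = ψ P := fun P ↦ rfl
  refine ⟨φ, hφ, fun P ↦ Subtype.ext ?_, fun σ P ↦ Subtype.ext ?_⟩
  · rw [hφ, hφ, hψψP]; rfl
  · rw [hφ, AddSubgroup.torsionBy.coe_smul, hrel]; rfl

/-! ## Conjunct (3) from (1), (2), (5): `√D` is not a scalar on `W[ℓ]` -/

omit [W.IsElliptic] in
/-- **Bézout on `W[ℓ]`**: if `ℓ` is prime and `ℓ ∤ k`, an `ℓ`-torsion point killed by `k` is zero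
(`1 = aℓ + bk`). [folklore] -/
theorem geomTorsion_eq_zero_of_zsmul_eq_zero {ℓ : ℕ} (hℓ : ℓ.Prime) {k : ℤ} (hk : ¬ (ℓ : ℤ) ∣ k)
    (Q : W.geomTorsion ℓ) (hQ : k • Q = 0) : Q = 0 := by
  have hprime : Prime (ℓ : ℤ) := Nat.prime_iff_prime_int.mp hℓ
  obtain ⟨a, b, hab⟩ := (Prime.coprime_iff_not_dvd hprime).mpr hk
  have hℓQ : (ℓ : ℤ) • Q = 0 := by rw [natCast_zsmul]; exact AddSubgroup.torsionBy.nsmul Q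
  calc Q = (a * ℓ + b * k) • Q := by rw [hab, one_zsmul]
    _ = 0 := by rw [add_zsmul, mul_zsmul, mul_zsmul, hℓQ, hQ, zsmul_zero, zsmul_zero, add_zero]

/-- **`W[ℓ] ≠ 0`** for a prime `ℓ` (indeed `#W[ℓ] = ℓ²`, Silverman *AEC* III.6.4(b), the tree's
`card_torsionPoints_eq_sq_holds`). [cite: SilvermanAEC2009, Cor. III.6.4(b)] -/
theorem exists_ne_zero_geomTorsion_prime {ℓ : ℕ} (hℓ : ℓ.Prime) : ∃ Q : W.geomTorsion ℓ, Q ≠ 0 := by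
  haveI : CharZero (AlgebraicClosure ℚ) :=
    charZero_of_injective_algebraMap (algebraMap ℚ (AlgebraicClosure ℚ)).injective
  have hcard : Nat.card (W.geomTorsion ℓ) = ℓ ^ 2 :=
    card_torsionPoints_eq_sq_holds W (AlgebraicClosure ℚ) (Nat.cast_ne_zero.mpr hℓ.ne_zero)
  have h1 : 1 < Nat.card (W.geomTorsion ℓ) := by
    rw [hcard]
    nlinarith [hℓ.two_le]
  haveI : Finite (W.geomTorsion ℓ) := Nat.finite_of_card_ne_zero (by omega)
  haveI : Nontrivial (W.geomTorsion ℓ) := Finite.one_lt_card_iff_nontrivial.mp h1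
  exact exists_ne 0

/-- **A twisted square root of `D` on `W[ℓ]` is not a scalar.** Let `ℓ` be an odd prime with
`ℓ ∤ D`, `φ` an endomorphism of `W[ℓ]` with `φ ∘ φ = D`, and `σ₀ ∈ Γ_ℚ` with
`φ(σ₀ • P) = −σ₀ • φ(P)` (the twist by `χ(σ₀) = −1`). Then `φ ≠ c` for every `c ∈ ℤ`: if `φ = c`
then `c(σ₀P) = −c(σ₀P)`, so `2c` kills `W[ℓ] ≠ 0` and `ℓ ∣ c` (Bézout), so `φ = 0` and `D = φ² = 0`
on `W[ℓ]`, so `ℓ ∣ D` — conjunct (3) of `cmTorsion_cartanImage` from (1), (2), (5). [folklore] -/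
theorem geomTorsion_ne_smul_of_twist {ℓ : ℕ} (hℓ : ℓ.Prime) (hℓ2 : ℓ ≠ 2) {D : ℤ}
    (hD : ¬ (ℓ : ℤ) ∣ D) (φ : AddMonoid.End (W.geomTorsion ℓ))
    (hφ : ∀ P : W.geomTorsion ℓ, φ (φ P) = D • P) {σ₀ : absoluteGaloisGroup ℚ}
    (hσ₀ : ∀ P : W.geomTorsion ℓ, φ (σ₀ • P) = -(σ₀ • φ P)) (c : ℤ) :
    ∃ P : W.geomTorsion ℓ, φ P ≠ c • P := by
  by_contra hall
  push Not at hall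
  obtain ⟨Q₀, hQ₀⟩ := W.exists_ne_zero_geomTorsion_prime hℓ
  have hprime : Prime (ℓ : ℤ) := Nat.prime_iff_prime_int.mp hℓ
  -- `2c` kills `W[ℓ]`
  have h2c : ∀ Q : W.geomTorsion ℓ, (2 * c) • Q = 0 := fun Q ↦ by
    have h := hσ₀ (σ₀⁻¹ • Q)
    rw [smul_inv_smul, hall, hall, smul_comm c σ₀⁻¹, smul_inv_smul] at h
    -- `h : c • Q = -(c • Q)`
    rw [mul_zsmul, two_zsmul]
    exact eq_neg_iff_add_eq_zero.mp h
  -- hence `ℓ ∣ 2c`, so `ℓ ∣ c` (`ℓ` odd)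
  have hℓc : (ℓ : ℤ) ∣ c := by
    by_contra hndvd
    have h2 : ¬ (ℓ : ℤ) ∣ 2 * c := fun h ↦ by
      rcases hprime.dvd_or_dvd h with h2 | h2
      · have : ℓ ∣ 2 := by exact_mod_cast h2
        exact hℓ2 ((Nat.prime_dvd_prime_iff_eq hℓ Nat.prime_two).mp this)
      · exact hndvd h2
    exact hQ₀ (W.geomTorsion_eq_zero_of_zsmul_eq_zero hℓ h2 Q₀ (h2c Q₀))
  -- so `φ = 0` on `W[ℓ]` and `D` kills `W[ℓ]`, whence `ℓ ∣ D`
  obtain ⟨m, hm⟩ := hℓc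
  have hφ0 : ∀ Q : W.geomTorsion ℓ, φ Q = 0 := fun Q ↦ by
    rw [hall, hm, mul_comm, mul_zsmul, natCast_zsmul, AddSubgroup.torsionBy.nsmul, zsmul_zero]
  have hDQ : D • Q₀ = 0 := by rw [← hφ, hφ0 Q₀, map_zero]
  exact hQ₀ (W.geomTorsion_eq_zero_of_zsmul_eq_zero hℓ hD Q₀ hDQ)

/-! ## Conjuncts (1)–(5) of the fact, with a threshold depending on the curve -/

/-- **The elementary part of `cmTorsion_cartanImage`, proved per curve.** For an elliptic curve
`W/ℚ` with complex multiplication there is `L` (here `max 2 |D|` for the `D < 0` of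
`exists_sq_eq_intCast_of_hasCM`) such that for every prime `ℓ > L` there are an endomorphism `φ`
of `W[ℓ]`, an integer `D` and a character `χ : Γ_ℚ →* ℤˣ` with (1) `φ ∘ φ = D`, (2) `ℓ ∤ D`,
(3) `φ` is no scalar `c ∈ ℤ`, (4) `χ ≠ 1`, (5) `φ(σ • P) = χ(σ) • σ • φ(P)` — conjuncts (1)–(5) of
the named fact `Literature.NumberTheory.EllipticCurves.cmTorsion_cartanImage` (Lang 1987, Ch. 10
§4) in its exact vocabulary, leaving open only the Cartan-image clause (6) (the main theorem of
complex multiplication proper) and the uniformity of the threshold in `W`.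
[cite: Lang1987, Ch. 10 §4, Remark] -/
theorem cmTorsion_sqrt_twist_of_hasCM (h : W.HasCM) :
    ∃ L : ℕ, ∀ ℓ : ℕ, ℓ.Prime → L < ℓ →
      ∃ (φ : AddMonoid.End (W.geomTorsion ℓ)) (D : ℤ) (χ : absoluteGaloisGroup ℚ →* ℤˣ),
        (∀ P : W.geomTorsion ℓ, φ (φ P) = D • P) ∧ ¬ (ℓ : ℤ) ∣ D ∧
        (∀ c : ℤ, ∃ P : W.geomTorsion ℓ, φ P ≠ c • P) ∧
        (∃ σ : absoluteGaloisGroup ℚ, χ σ ≠ 1) ∧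
        (∀ (σ : absoluteGaloisGroup ℚ) (P : W.geomTorsion ℓ),
          φ (σ • P) = ((χ σ : ℤˣ) : ℤ) • σ • φ P) := by
  obtain ⟨ψ, -, D, χ, hD, -, hne, hT⟩ := W.exists_sqrt_twist_geomTorsion_of_hasCM h
  refine ⟨max 2 D.natAbs, fun ℓ hℓ hlt ↦ ?_⟩
  obtain ⟨φ, -, hφφ, hrel⟩ := hT ℓ
  have hℓ2 : ℓ ≠ 2 := by intro h2; rw [h2] at hlt; exact absurd hlt (by simp)
  have hℓD : ¬ (ℓ : ℤ) ∣ D := fun hdvd ↦ by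
    have h1 : ℓ ∣ D.natAbs := Int.natCast_dvd.mp hdvd
    have h2 : ℓ ≤ D.natAbs := Nat.le_of_dvd (Int.natAbs_pos.mpr (by omega)) h1
    exact absurd (lt_of_le_of_lt (le_max_right 2 D.natAbs) hlt) (not_lt.mpr h2)
  obtain ⟨σ₀, hσ₀⟩ := hne
  have hσ₀' : χ σ₀ = -1 := (Int.units_eq_one_or (χ σ₀)).resolve_left hσ₀
  have hanti : ∀ P : W.geomTorsion ℓ, φ (σ₀ • P) = -(σ₀ • φ P) := fun P ↦ by
    rw [hrel, hσ₀', Units.val_neg, Units.val_one, neg_one_zsmul]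
  exact ⟨φ, D, χ, hφφ, hℓD, fun c ↦ W.geomTorsion_ne_smul_of_twist hℓ hℓ2 hℓD φ hφφ hanti c,
    ⟨σ₀, hσ₀⟩, hrel⟩

end WeierstrassCurve

/-! ## Reduction of the named fact: conjunct (3) is redundant -/

namespace Literature.NumberTheory.EllipticCurves

open WeierstrassCurve
open Field (absoluteGaloisGroup)

/-- **`cmTorsion_cartanImage` without its non-scalarity clause implies `cmTorsion_cartanImage`.**
For the literature-prover discharging the fact: it suffices to produce, uniformly beyond some `L₀`,
the data `φ`, `D`, `χ` with (1) `φ² = D`, (2) `ℓ ∤ D`, (4) `χ ≠ 1`, (5) the twist and (6) the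
Cartan image; conjunct (3) (`φ` is no scalar) then follows for `ℓ > max 2 L₀` by
`WeierstrassCurve.geomTorsion_ne_smul_of_twist`. [cite: Lang1987, Ch. 10 §4, Remark and Thm. 8] -/
theorem cmTorsion_cartanImage_of_sqrt_twist_cartan
    (h : ∃ L₀ : ℕ, ∀ (W : WeierstrassCurve ℚ) [W.IsElliptic], W.HasCM → ∀ ℓ : ℕ, ℓ.Prime → L₀ < ℓ →
      ∃ (φ : AddMonoid.End (W.geomTorsion ℓ)) (D : ℤ) (χ : absoluteGaloisGroup ℚ →* ℤˣ),
        (∀ P : W.geomTorsion ℓ, φ (φ P) = D • P) ∧ ¬ (ℓ : ℤ) ∣ D ∧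
        (∃ σ : absoluteGaloisGroup ℚ, χ σ ≠ 1) ∧
        (∀ (σ : absoluteGaloisGroup ℚ) (P : W.geomTorsion ℓ),
          φ (σ • P) = ((χ σ : ℤˣ) : ℤ) • σ • φ P) ∧
        (∀ a b : ℤ, ¬ (ℓ : ℤ) ∣ a ^ 2 - D * b ^ 2 →
          ∃ σ : absoluteGaloisGroup ℚ, χ σ = 1 ∧ ∀ P : W.geomTorsion ℓ,
            σ • P = (((a : AddMonoid.End (W.geomTorsion ℓ)) +
              (b : AddMonoid.End (W.geomTorsion ℓ)) * φ) ^ 12) P)) :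
    cmTorsion_cartanImage := by
  obtain ⟨L₀, hL⟩ := h
  refine ⟨max 2 L₀, fun W _ hCM ℓ hℓ hlt ↦ ?_⟩
  obtain ⟨φ, D, χ, h1, h2, h4, h5, h6⟩ := hL W hCM ℓ hℓ (lt_of_le_of_lt (le_max_right 2 L₀) hlt)
  have hℓ2 : ℓ ≠ 2 := by intro h2'; rw [h2'] at hlt; exact absurd hlt (by simp)
  obtain ⟨σ₀, hσ₀⟩ := h4
  have hσ₀' : χ σ₀ = -1 := (Int.units_eq_one_or (χ σ₀)).resolve_left hσ₀
  have hanti : ∀ P : W.geomTorsion ℓ, φ (σ₀ • P) = -(σ₀ • φ P) := fun P ↦ by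
    rw [h5, hσ₀', Units.val_neg, Units.val_one, neg_one_zsmul]
  exact ⟨φ, D, χ, h1, h2, fun c ↦ W.geomTorsion_ne_smul_of_twist hℓ hℓ2 h2 φ h1 hanti c,
    ⟨σ₀, hσ₀⟩, h5, h6⟩

end Literature.NumberTheory.EllipticCurves

end
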